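import Summits.QuantumFields.BalabanUV.InfraRed.StrongCouplingEightFifthsCovariance
import Summits.QuantumFields.BalabanUV.InfraRed.StrongCouplingForestDoor
import HarnessLib

/-!
# Strong-coupling front, rung F4 PROVED (part 4/4): the quarter modulus `OneLinkKRModulusSU2 β_W (1/4)` for every
Wilson `0 ≤ β_W ≤ 4/15` — hence `QuarterModulusUpTo (4/15)` and R21's `QuarterModulus` BY NAME —
observatory of the non-perturbative crossover; no mass-gap claim

IR-3 v2 TWO-FRONT CROSSOVER LEDGER, front SC (`β₀`), SU(2), `d = 4`, Wilson normalisation `β_W = 4/g²`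
(tree bare coupling `β_t = β_W/2`, 't Hooft `β_W/4`).
ABSOLUTE RULE of this package: No internally-minted statement may enter as a cited fact. Every hypothesis is either
kernel-proved in this package or a verbatim quotation of a PUBLISHED theorem with page reference. The manuscript(s)
under audit are NOT citable for their own disputed steps — they are the thing under adjudication; programme-internal
(2001/route/tribunal) claims are never citable.

WHAT THIS FILE PROVES (kernel, every hypothesis discharged).
* `oneLinkKRModulusSU2_of_le_fourFifteenths`: for `0 ≤ β_W ≤ 4/15` the `SU(2)` one-link Kantorovich–Rubinstein
  modulus with the floor constant `K₂ = 1/4` on the ball `‖B‖_op ≤ 3β_W/2 ≤ 2/5` — integration of part 3's covariance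
  bound `quarterCovariance85` along the segment `B_t = B + t(B′ − B)` (the tree's `abs_integral_tilted_add_sub_le_of_cov`,
  exactly as in `quarterModulus_of_quarterCovariance`).
* `quarterModulusUpTo_fourFifteenths : QuarterModulusUpTo (4/15)` — rung **F4** of the forest-gauge line
  (`StrongCouplingForestGauge`), the tilt ball `κ = 6β_W ≤ 8/5`.
* `quarterModulus : StrongCouplingDobrushinFloor.QuarterModulus` — R21's typed target, now a theorem by name (it was
  reachable before only through `quarterModulus_of_quarterCovariance quarterCovariance`).
* `su2_strongCouplingFront_lt_fourFifteenths`: the strong-coupling front `CrossoverLedger.StrongCouplingFront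
  (fundamentalLatticeRep 2) (β_W/2)` (currency SC-b: torus exponential clustering of gauge-invariant cylinder observables,
  uniform in the volume) at EVERY Wilson `0 ≤ β_W < 4/15 = 0.2667`, EVERY HYPOTHESIS DISCHARGED — the forest Dobrushin
  door (`StrongCouplingForestDoor.forestDobrushinDoor`, rungs F2 + F3) × F1-15 (`eventualForestRowBound_fifteen`) × F4
  (this file); `15 · β_W · (1/4) < 1 ⟺ β_W < 4/15`, endpoint NOT attained (strict Dobrushin row sum).  Instance
  `su2_strongCouplingFront_quarter` at `β_W = 1/4 > 2/9`.

LEDGER CONSEQUENCE (stated, not adjudicated here): the package's owned strong-coupling number in currency SC-b moves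
from `β_W < 2/9 = 0.2222` (18-row comb door; closed endpoint `2/9` by `StrongCouplingForestDoor`) to `β_W < 4/15 =
0.2667` (forest door); currencies SC-a (DLR uniqueness) and SC-c (infinite-volume mass gap) are NOT touched by the
forest door and stay at the comb door's `2/9`.

NOT CLAIMED: no mass-gap claim; nothing at or beyond `β_W = 4/15`; SC-a ∕ SC-c untouched (they stay at `2/9`);
nothing about the continuum, `N ≥ 3`, or the crossover itself; NOT Bałaban's renormalisation group; the manuscripts
under audit are cited nowhere.
-/

noncomputable section

open MeasureTheory Filter Topology ProbabilityTheory Finset Real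
open scoped NNReal Quaternion
open Literature.Probability.LatticeModels
open Literature.MathematicalPhysics.QuantumLattice (fundamentalRep fundamentalLatticeRep quatMatrix su2Quat quatToSU2)
open Literature.MathematicalPhysics.QuantumFieldTheory
open Literature.MathematicalPhysics.QuantumFieldTheory.Balaban1983to89
open Literature.MathematicalPhysics.QuantumFieldTheory.Balaban1983to89.StrongCouplingDobrushinWindow
open Literature.MathematicalPhysics.QuantumFieldTheory.Balaban1983to89.StrongCouplingTorusWindow
open Literature.MathematicalPhysics.QuantumFieldTheory.Balaban1983to89.StrongCouplingKernelWindow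
open Literature.MathematicalPhysics.QuantumFieldTheory.Balaban1983to89.StrongCouplingOpenWindow
open Literature.MathematicalPhysics.QuantumFieldTheory.Balaban1983to89.StrongCouplingVarianceWindow
open Summit.QuantumFields.BalabanUV.InfraRed.StrongCouplingSixFifthsVariance
open Summit.QuantumFields.BalabanUV.InfraRed.StrongCouplingReflection
open Summit.QuantumFields.BalabanUV.InfraRed.StrongCouplingTransverseMoment
open Summit.QuantumFields.BalabanUV.InfraRed.StrongCouplingQuarterCovariance
open Summit.QuantumFields.BalabanUV.InfraRed.StrongCouplingEightFifthsCovariance (quarterCovariance85)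
open Summit.QuantumFields.BalabanUV.InfraRed.StrongCouplingForestGauge
open Summit.QuantumFields.BalabanUV.InfraRed.StrongCouplingStaggerForest (su2_strongCouplingFront_whatIf15)
open Summit.QuantumFields.BalabanUV.InfraRed.StrongCouplingForestDoor (forestDobrushinDoor)

namespace Summit.QuantumFields.BalabanUV.InfraRed.StrongCouplingQuarterModulusFourFifteenths


/-! ## 1. The one-link quarter modulus up to `β_W = 4/15` -/

/-- **The `SU(2)` one-link quarter modulus for `0 ≤ β_W ≤ 4/15`** (`‖B‖_op, ‖B′‖_op ≤ 3β_W/2 ≤ 2/5`; `β_W ≥ 0` is not needed): for every bounded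
measurable `L`-Lipschitz `φ`, `|∫ φ dν_B − ∫ φ dν_{B′}| ≤ 4 · (1/4) · L · ‖B − B′‖_F` — integration of `quarterCovariance85`
along the segment, which stays in the ball `‖B_t‖_op ≤ 2/5`. [folklore] -/
theorem oneLinkKRModulusSU2_of_le_fourFifteenths {βW : ℝ} (h415 : βW ≤ 4 / 15) :
    OneLinkKRModulusSU2 βW (1 / 4) := by
  classical
  intro B B' hB hB' φ L hφm hφb hL hφL
  have h2 : ((2 : ℕ) : ℝ) = 2 := by norm_num
  rw [h2, show (4 : ℝ) * (1 / 4) = 1 by norm_num, one_mul]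
  set f : Matrix.specialUnitaryGroup (Fin 2) ℂ → ℝ := fun g => (2 : ℝ) * (((g : Matrix (Fin 2) (Fin 2) ℂ) * B).trace.re) with hf
  set w : Matrix.specialUnitaryGroup (Fin 2) ℂ → ℝ := fun g => (2 : ℝ) * (((g : Matrix (Fin 2) (Fin 2) ℂ) * (B' - B)).trace.re) with hw
  have hfw : (fun g : Matrix.specialUnitaryGroup (Fin 2) ℂ => (2 : ℝ) * (((g : Matrix (Fin 2) (Fin 2) ℂ) * B').trace.re)) = fun g => f g + w g := by
    funext g
    simp only [hf, hw, Matrix.mul_sub, Matrix.trace_sub, Complex.sub_re]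
    ring
  rw [hfw, abs_sub_comm]
  have hfm : Measurable f := (continuous_pot B).measurable
  have hwm : Measurable w := (continuous_pot (B' - B)).measurable
  have hfb : ∃ C, ∀ s, |f s| ≤ C := ⟨_, abs_pot_le B⟩
  have hwb : ∀ s, |w s| ≤ 2 * (Real.sqrt 2 * frobNorm (B' - B)) := abs_pot_le (B' - B)
  have key := abs_integral_tilted_add_sub_le_of_cov (μ := (haarProbability (Matrix.specialUnitaryGroup (Fin 2) ℂ))) (A := L * frobNorm (B' - B)) hfm hfb hwm hwb hφm hφb ?_
  · rw [frobNorm_sub_comm]; exact key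
  · intro t ht
    set Bt : Matrix (Fin 2) (Fin 2) ℂ := B + (t : ℂ) • (B' - B) with hBt
    have hft : (fun u : Matrix.specialUnitaryGroup (Fin 2) ℂ => f u + t * w u) = pot Bt := by
      funext g
      simp only [hf, hw, hBt, pot, Matrix.mul_add, Matrix.mul_smul, Matrix.trace_add, Matrix.trace_smul,
        Complex.add_re, smul_eq_mul, Complex.re_ofReal_mul]
      ring
    have hBt_le : matrixOpNorm Bt ≤ 2 / 5 := by
      have h1 : Bt = ((1 - t : ℝ) : ℂ) • B + ((t : ℝ) : ℂ) • B' := by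
        rw [hBt]
        push_cast
        simp only [smul_sub, sub_smul, one_smul]
        abel
      rw [h1]
      calc matrixOpNorm (((1 - t : ℝ) : ℂ) • B + ((t : ℝ) : ℂ) • B')
          ≤ matrixOpNorm (((1 - t : ℝ) : ℂ) • B) + matrixOpNorm (((t : ℝ) : ℂ) • B') := matrixOpNorm_add_le _ _
        _ = (1 - t) * matrixOpNorm B + t * matrixOpNorm B' := by
            rw [matrixOpNorm_smul, matrixOpNorm_smul, Complex.norm_real, Complex.norm_real, Real.norm_eq_abs,
              Real.norm_eq_abs, abs_of_nonneg (by linarith [ht.2]), abs_of_nonneg ht.1]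
        _ ≤ (1 - t) * (3 * βW / 2) + t * (3 * βW / 2) :=
            add_le_add (mul_le_mul_of_nonneg_left hB (by linarith [ht.2])) (mul_le_mul_of_nonneg_left hB' ht.1)
        _ ≤ 2 / 5 := by linarith
    rw [hft]
    exact quarterCovariance85 Bt (B' - B) hBt_le φ L hφm hφb hL hφL

/-- **Rung F4 PROVED**: the quarter modulus up to `4/15` (`StrongCouplingForestGauge.QuarterModulusUpTo (4/15)`, the
hypothesis of the `D = 15` forest door). [folklore] -/
theorem quarterModulusUpTo_fourFifteenths : QuarterModulusUpTo (4 / 15) := fun _ _ hlt =>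
  oneLinkKRModulusSU2_of_le_fourFifteenths hlt.le

/-- **R21's typed target `QuarterModulus` is a theorem** (`0 ≤ β_W ≤ 2/9 ≤ 4/15`). [folklore] -/
theorem quarterModulus : StrongCouplingDobrushinFloor.QuarterModulus := fun _ _ h29 =>
  oneLinkKRModulusSU2_of_le_fourFifteenths (h29.trans (by norm_num))

/-! ## 2. The strong-coupling front below `4/15`, every hypothesis discharged -/

/-- **The `SU(2)` strong-coupling front (SC-b) at every Wilson `0 ≤ β_W < 4/15`** — forest Dobrushin door (F2 + F3,
`StrongCouplingForestDoor.forestDobrushinDoor`) × F1-15 (`eventualForestRowBound_fifteen`) × F4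
(`quarterModulusUpTo_fourFifteenths`); no hypothesis. [folklore] -/
theorem su2_strongCouplingFront_lt_fourFifteenths {β₀W : ℝ} (h0 : 0 ≤ β₀W) (hlt : β₀W < 4 / 15) :
    CrossoverLedger.StrongCouplingFront (fundamentalLatticeRep 2) (β₀W / 2) :=
  su2_strongCouplingFront_whatIf15 forestDobrushinDoor quarterModulusUpTo_fourFifteenths h0 hlt

/-- Instance: SC-b at Wilson `β_W = 1/4` (tree bare coupling `1/8`) — strictly above the comb door's ceiling `2/9`.
[folklore] -/
theorem su2_strongCouplingFront_quarter :
    CrossoverLedger.StrongCouplingFront (fundamentalLatticeRep 2) ((1 / 4 : ℝ) / 2) :=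
  su2_strongCouplingFront_lt_fourFifteenths (by norm_num) (by norm_num)

end Summit.QuantumFields.BalabanUV.InfraRed.StrongCouplingQuarterModulusFourFifteenths
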